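import Summits.BirchSwinnertonDyer.BirchSwinnertonDyer.Theorems.AlignedTransportAtTwoMainConjectureTransportAlignedAtTwoKilfordCopyCrossLevelFactor
import Literature.NumberTheory.EllipticCurves.ModularJacobianModPMultiplicityOne
import HarnessLib

/-!
# Crux C1 `MainConjectureTransportAlignedAtTwo` (stmt-BirchSwinnertonDyer-22296), line `birth`, residual (R2) `stub_lamLawKilford`, UNEQUAL conductors,
# general «factor-and-absorb»: THE HECKE ROWS OF THE GENERALISED OLD FORM `F = Σ_m R_m·m·ι_m f` at the common level `L` — `T_p F = a_p F` off `S`,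
# and at `ℓ ∈ S` the `U_ℓ`-half-periods move by `β_ℓ` modulo INTEGRAL periods: «`θ_F` kills `𝔪·J₀(L)[2]`» for the common mod-`2` eigen-ideal
# (width seat att-p3 g19; `--supports 22296`)

THEOREMS ONLY (no `def`, no `sorry`, no named fact). The analogue, for the general side operator `R = ∏_{ℓ∈S}([1] + ρ_ℓ[ℓ] + σ_ℓ[ℓ²])` of
`…KilfordCopyCrossLevelFactor`, of att-p3 g18's `…CrossLevelOldLinesHecke` / `…OldLinesHeckeIdeal` (the case `R_ℓ ∈ {1, [1]+[ℓ]}`). Everything is done on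
MODULAR SYMBOLS (Cremona (2.4.1)–(2.4.2): `{∞, r}_{T_p F} = Σ_{j<p}{∞, (r+j)/p}_F + 𝟙_{p∤L}{∞, pr}_F`, tree `modularSymbol_heckeT_eq_sum`) with cell bsd-wall's
symbol-level Hecke calculus (`heckeRel_act_of_coprime`, `sum_fin_apply_mul_self_div`, `sum_fin_apply_sq_mul_div`): no `q`-expansion of `F` is needed, only
its symbols `{∞, s}_F = (R·{∞,·}_f)(s)`. KEY IDENTITY at `ℓ ∈ S` (`Φ = (∏_{S∖ℓ}R)·ψ`, `a = a_ℓ(f)`, `𝟙 = 𝟙_{ℓ∤N}`):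
`U_ℓ{∞,·}_F − β{∞,·}_F = (a + ρℓ − β)·Φ + (σℓ − 𝟙 − βρ)·Φ(ℓ·) − βσ·Φ(ℓ²·)`, and the reduction's constraints at `ℓ` (`βσ = 0`, `β + ρ ≡ a`,
`βρ + σ ≡ 𝟙 (mod 2)`, with `ε = 0`) are EXACTLY «both coefficients even»: the generalised old form carries the mod-`2` eigenvalue `β_ℓ` of the COMMON
factor `C_ℓ = [1] + β_ℓ[ℓ]` at every `ℓ ∈ S` — so BOTH old forms `F₁, F₂` of the reduction have the SAME mod-`2` Hecke eigensystem
`(a_p (p ∉ S), β_ℓ (ℓ ∈ S))`. BSD is not proved by this; C1 is not closed by this.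

* §1 `dvd_of_mem_support_prod_factor` (support of `R` ⊆ divisors of `∏ℓ^{e_ℓ}`), `modularSymbol_heckeRel` (the `p`-Hecke relation of `{∞,·}_f`).
* §2 **`apply_heckeT_factorForm_of_not_mem`** — `y(T_p F) = a_p(f)·y(F)` for `p ∉ S` prime, `p ∤ L`, `p ∤ N`, every `y ∈ H₁(X₀(L);ℤ)`.
* §3 **`apply_heckeT_factorForm_of_mem`** — for `ℓ ∈ S`, `ℓ ∣ L`: `c·y(U_ℓ F) = β_ℓ·(c·y(F)) + 2z`, `z ∈ Λ` (`Λ ⊇ c·Λ_f`).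
* §4 **`factorForm_half_smul_mem_of_mem_span`** — for every `t` in the ideal of `𝕋_ℤ(L)` generated by `2`, the `T_p − a_p(f)` (`p ∉ S` prime) and the
  `T_ℓ − β_ℓ` (`ℓ ∈ S`), and every `y ∈ H₁(X₀(L);ℤ)`: `c·(t•y)(F)/2 ∈ Λ` (when every prime of `L` is in `S` and `N ∣ L`).

References: Cremona 1997 §2.4 (2.4.1)–(2.4.2), §2.10 [CremonaAlgorithms1997]; Diamond–Shurman 2005 Prop. 5.6.2 [DiamondShurman2005]; Darmon–Diamond–Taylor
1995 §1.3, §4.1 [DarmonDiamondTaylor1995]; Mazur–Tate–Teitelbaum 1986 §I.4 [MazurTateTeitelbaum1986Invent].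
-/

noncomputable section

-- justification: the `Summit.BirchSwinnertonDyer.BirchSwinnertonDyer.…` path repeats a component (route-file convention)
set_option linter.dupNamespace false
set_option autoImplicit false

open scoped MatrixGroups ModularForm Classical

open CongruenceSubgroup Complex
open Literature.NumberTheory.EllipticCurves Literature.NumberTheory.EllipticCurves.ModularForms
open Summit.BirchSwinnertonDyer.BirchSwinnertonDyer.Theorems.ThetaLayerLambdaCongruenceAtTwo
open Summit.BirchSwinnertonDyer.BirchSwinnertonDyer.Theorems.AlignedTransportAtTwoDepletedPeriodFormula
open Summit.BirchSwinnertonDyer.BirchSwinnertonDyer.Theorems.AlignedTransportAtTwoKilfordCopyCrossLevelTools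
open Summit.BirchSwinnertonDyer.BirchSwinnertonDyer.Theorems.AlignedTransportAtTwoKilfordCopyCrossLevelFactor

namespace Summit.BirchSwinnertonDyer.BirchSwinnertonDyer.Theorems.AlignedTransportAtTwoKilfordCopyCrossLevelFactorHecke

/-! ## §1 Support of the side operator; the Hecke relation of `{∞,·}_f` -/

/-- **The side operator is supported on divisors of `∏_{ℓ∈S} ℓ^{e_ℓ}`** (`ρ_ℓ = 0` unless `e_ℓ ≥ 1`, `σ_ℓ = 0` unless `e_ℓ ≥ 2`): support of a product
⊆ product of supports. [folklore] -/
theorem dvd_of_mem_support_prod_factor (ρ σ : ℕ → ℤ) (e : ℕ → ℕ) (S : Finset ℕ)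
    (hρ : ∀ ℓ ∈ S, e ℓ = 0 → ρ ℓ = 0) (hσ : ∀ ℓ ∈ S, e ℓ ≤ 1 → σ ℓ = 0) :
    ∀ m ∈ ((∏ ℓ ∈ S, (MonoidAlgebra.single 1 (1 : ℂ) + MonoidAlgebra.single ℓ ((ρ ℓ : ℤ) : ℂ) +
      MonoidAlgebra.single (ℓ ^ 2) ((σ ℓ : ℤ) : ℂ)) : MonoidAlgebra ℂ ℕ)).coeff.support, m ∣ ∏ ℓ ∈ S, ℓ ^ e ℓ := by
  classical
  induction S using Finset.induction_on with
  | empty =>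
    intro m hm
    rw [Finset.prod_empty, MonoidAlgebra.one_def, MonoidAlgebra.coeff_single] at hm
    rw [Finset.prod_empty, Finset.mem_singleton.mp (Finsupp.support_single_subset hm)]
  | insert ℓ S hℓS ih =>
    intro m hm
    rw [Finset.prod_insert hℓS] at hm
    obtain ⟨a, ha, b, hb, rfl⟩ := Finset.mem_mul.mp (MonoidAlgebra.support_coeff_mul_subset _ _ hm)
    rw [Finset.prod_insert hℓS]
    refine mul_dvd_mul ?_ (ih (fun ℓ' h ↦ hρ ℓ' (Finset.mem_insert_of_mem h)) (fun ℓ' h ↦ hσ ℓ' (Finset.mem_insert_of_mem h)) b hb)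
    -- `a` lies in the support of the factor at `ℓ`: `a ∈ {1} ∪ {ℓ} ∪ {ℓ²}` with the corresponding coefficient non-zero
    rw [MonoidAlgebra.coeff_add, MonoidAlgebra.coeff_add, MonoidAlgebra.coeff_single, MonoidAlgebra.coeff_single, MonoidAlgebra.coeff_single] at ha
    rcases Finset.mem_union.mp (Finsupp.support_add ha) with ha | ha
    · rcases Finset.mem_union.mp (Finsupp.support_add ha) with ha | ha
      · rw [Finset.mem_singleton.mp (Finsupp.support_single_subset ha)]; exact one_dvd _
      · obtain ⟨hal, hne⟩ := (Finsupp.mem_support_single _ _ _).mp ha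
        rw [hal]
        have he : 1 ≤ e ℓ := Nat.one_le_iff_ne_zero.mpr fun h ↦ hne (by rw [hρ ℓ (Finset.mem_insert_self ℓ S) h, Int.cast_zero])
        simpa only [pow_one] using pow_dvd_pow ℓ he
    · obtain ⟨hal, hne⟩ := (Finsupp.mem_support_single _ _ _).mp ha
      rw [hal]
      have he : 2 ≤ e ℓ := by
        by_contra h
        exact hne (by rw [hσ ℓ (Finset.mem_insert_self ℓ S) (by omega), Int.cast_zero])
      exact pow_dvd_pow ℓ he

/-- **The `p`-Hecke relation of the modular symbols of an eigenform**: `T_p f = a·f` (`p` prime) gives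
`a·{∞, r}_f = Σ_{j<p}{∞, (r+j)/p}_f + 𝟙_{p∤N}·p·p⁻¹·{∞, p r}_f` — the relation of `heckeRel_act_of_coprime` with `c = 𝟙_{p∤N}·p`.
[cite: CremonaAlgorithms1997, §2.4 (2.4.1)–(2.4.2)] -/
theorem modularSymbol_heckeRel {N : ℕ} [NeZero N] (f : CuspForm (Gamma0 N) 2) {p : ℕ} (hp : p.Prime) (a : ℂ)
    (hT : (haveI : NeZero p := ⟨hp.ne_zero⟩; heckeT (Gamma0 N) 2 p f) = a • f) (r : ℚ) :
    a * modularSymbol f r = (∑ j : Fin p, modularSymbol f ((r + j) / p)) +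
      (if p ∣ N then 0 else (p : ℂ)) * (p : ℂ)⁻¹ * modularSymbol f ((p : ℚ) * r) := by
  haveI : NeZero p := ⟨hp.ne_zero⟩
  have h := modularSymbol_heckeT_eq_sum p f hp r
  rw [hT, modularSymbol_const_smul] at h
  rw [h]
  simp only [Int.cast_natCast]
  have hp0 : (p : ℂ) ≠ 0 := by exact_mod_cast hp.ne_zero
  split_ifs <;> simp [mul_inv_cancel₀ hp0]

/-! ## §2 Off `S`: `y(T_p F) = a_p·y(F)` -/

/-- **The generalised old form is a `T_p`-eigenvector on cycles, off `S`**: for a prime `p ∉ S` with `p ∤ N` and `p ∤ L`, `T_p f = a·f`, and ANY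
`F ∈ S₂(Γ₀(L))` with `{∞, s}_F = (R·{∞,·}_f)(s)` (`R = ∏_{ℓ∈S}([1] + ρ_ℓ[ℓ] + σ_ℓ[ℓ²])`, all `ℓ ∈ S` prime): `y(T_p F) = a·y(F)` for every
`y ∈ H₁(X₀(L);ℤ)` — the support of `R` is prime to `p` (`dvd_of_mem_support_prod_factor`), so `R` transports the `p`-relation of `{∞,·}_f`
(`heckeRel_act_of_coprime`). [cite: CremonaAlgorithms1997, §2.4 (2.4.1)–(2.4.2)] [cite: DiamondShurman2005, Prop. 5.6.2] -/
theorem apply_heckeT_factorForm_of_not_mem {N L : ℕ} [NeZero N] [NeZero L] (f : CuspForm (Gamma0 N) 2)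
    (ρ σ : ℕ → ℤ) (e : ℕ → ℕ) (S : Finset ℕ) (hS : ∀ ℓ ∈ S, ℓ.Prime)
    (hρ : ∀ ℓ ∈ S, e ℓ = 0 → ρ ℓ = 0) (hσ : ∀ ℓ ∈ S, e ℓ ≤ 1 → σ ℓ = 0)
    (F : CuspForm (Gamma0 L) 2)
    (hF : ∀ s : ℚ, modularSymbol F s =
      ((∏ ℓ ∈ S, (MonoidAlgebra.single 1 (1 : ℂ) + MonoidAlgebra.single ℓ ((ρ ℓ : ℤ) : ℂ) +
        MonoidAlgebra.single (ℓ ^ 2) ((σ ℓ : ℤ) : ℂ)) : MonoidAlgebra ℂ ℕ).coeff.sum fun m a ↦ a * modularSymbol f ((m : ℚ) * s)))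
    {p : ℕ} (hp : p.Prime) (hpS : p ∉ S) (hpN : ¬ p ∣ N) (hpL : ¬ p ∣ L) (a : ℂ)
    (hT : (haveI : NeZero p := ⟨hp.ne_zero⟩; heckeT (Gamma0 N) 2 p f) = a • f) :
    ∀ y ∈ periodHomology L, (haveI : NeZero p := ⟨hp.ne_zero⟩; y (heckeT (Gamma0 L) 2 p F)) = a * y F := by
  haveI : NeZero p := ⟨hp.ne_zero⟩
  intro y hy
  have hy' : y ∈ (periodHomology L : Set (Module.Dual ℂ (CuspForm (Gamma0 L) 2))) := hy
  rw [coe_periodHomology_eq_range] at hy'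
  obtain ⟨γ, rfl⟩ := hy'
  rw [periodFunctional_apply, periodFunctional_apply]
  by_cases hγ : (γ : SL(2, ℤ)) 1 0 = 0
  · simp only [cuspSymbol, if_pos hγ, mul_zero]
  set r : ℚ := (((γ : SL(2, ℤ)) 0 0 : ℚ) / ((γ : SL(2, ℤ)) 1 0 : ℚ)) with hr
  rw [cuspSymbol, if_neg hγ, cuspSymbol, if_neg hγ, modularSymbol_heckeT_eq_sum p F hp, if_neg hpL]
  simp only [Int.cast_natCast, hF]
  -- transport the `p`-relation of `{∞,·}_f` through `R` (support prime to `p`)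
  have hcop : ∀ m ∈ ((∏ ℓ ∈ S, (MonoidAlgebra.single 1 (1 : ℂ) + MonoidAlgebra.single ℓ ((ρ ℓ : ℤ) : ℂ) +
      MonoidAlgebra.single (ℓ ^ 2) ((σ ℓ : ℤ) : ℂ)) : MonoidAlgebra ℂ ℕ)).coeff.support, m.Coprime p := by
    intro m hm
    refine Nat.Coprime.coprime_dvd_left (dvd_of_mem_support_prod_factor ρ σ e S hρ hσ m hm) ?_
    refine Nat.coprime_prod_left_iff.mpr fun ℓ hℓ ↦ Nat.Coprime.pow_left _ ?_
    exact (Nat.coprime_primes (hS ℓ hℓ) hp).mpr (fun h ↦ hpS (h ▸ hℓ))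
  have hrel := modularSymbol_heckeRel f hp a hT
  simp only [if_neg hpN] at hrel
  have key := heckeRel_act_of_coprime (modularSymbol f) (modularSymbol_add_intCast_holds f) hp.pos hrel _ hcop r
  have hp0 : (p : ℂ) ≠ 0 := by exact_mod_cast hp.ne_zero
  rw [mul_inv_cancel₀ hp0, one_mul] at key
  exact key.symm

/-! ## §3 At `ℓ ∈ S`: `c·y(U_ℓ F) ≡ β_ℓ·c·y(F)` modulo `2Λ` -/

/-- **The `U_ℓ`-row of the generalised old form, `ℓ ∈ S`.** Data as in `…Factor.exists_factorForm` (`N·∏ℓ^{e_ℓ} ∣ L`, all `ℓ ∈ S` prime), `ℓ ∈ S`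
with `ℓ ∣ L`, `T_ℓ f = a_ℓ(f)·f` with `a_ℓ(f) = A` an integer, `Λ ⊇ c·Λ_f`, and an integer `β` with the reduction's constraints AT `ℓ`:
`βσ_ℓ = 0`, `β + ρ_ℓ ≡ A`, `βρ_ℓ + σ_ℓ ≡ 𝟙_{ℓ∤N} (mod 2)`. Then for every `y ∈ H₁(X₀(L);ℤ)` there is `z ∈ Λ` with
`c·y(U_ℓ F) = β·(c·y(F)) + 2z`. Mechanism (`Φ = (∏_{S∖ℓ}R)·{∞,·}_f`, periodic, support prime to `ℓ`, so it satisfies the `ℓ`-relation of `f`):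
`U_ℓ{∞,·}_F = U_ℓΦ + ρℓ·Φ + σℓ·Φ(ℓ·) = (A + ρℓ)Φ + (σℓ − 𝟙)Φ(ℓ·)`, while `β{∞,·}_F = βΦ + βρΦ(ℓ·) + βσΦ(ℓ²·)`; the differences of coefficients
are even by the constraints, and `c·Φ(r)`, `c·Φ(ℓr)` are integral periods. [cite: CremonaAlgorithms1997, §2.4 (2.4.1)–(2.4.2)]
[cite: MazurTateTeitelbaum1986Invent, §I.4 (4.2)] [cite: DiamondShurman2005, Prop. 5.6.2] -/
theorem apply_heckeT_factorForm_of_mem {N L : ℕ} [NeZero N] [NeZero L] (f : CuspForm (Gamma0 N) 2) (A : ℕ → ℤ)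
    (hA : ∀ n, cuspCoeff f n = A n)
    (hT : ∀ (p : ℕ) (hp : p.Prime), (haveI : NeZero p := ⟨hp.ne_zero⟩; heckeT (Gamma0 N) 2 p f) = cuspCoeff f p • f)
    (ρ σ : ℕ → ℤ) (e : ℕ → ℕ) (S : Finset ℕ) (hS : ∀ ℓ ∈ S, ℓ.Prime)
    (hρ : ∀ ℓ ∈ S, e ℓ = 0 → ρ ℓ = 0) (hσ : ∀ ℓ ∈ S, e ℓ ≤ 1 → σ ℓ = 0) (hL : N * ∏ ℓ ∈ S, ℓ ^ e ℓ ∣ L)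
    (F : CuspForm (Gamma0 L) 2)
    (hF : ∀ s : ℚ, modularSymbol F s =
      ((∏ ℓ ∈ S, (MonoidAlgebra.single 1 (1 : ℂ) + MonoidAlgebra.single ℓ ((ρ ℓ : ℤ) : ℂ) +
        MonoidAlgebra.single (ℓ ^ 2) ((σ ℓ : ℤ) : ℂ)) : MonoidAlgebra ℂ ℕ).coeff.sum fun m a ↦ a * modularSymbol f ((m : ℚ) * s)))
    (Λ : AddSubgroup ℂ) (c : ℂ) (hc : ∀ z ∈ periodLattice f, c * z ∈ Λ)
    {ℓ : ℕ} (hℓ : ℓ ∈ S) (hℓodd : Odd ℓ) (hℓL : ℓ ∣ L) (β : ℤ) (hx : β * σ ℓ = 0) (hb : (2 : ℤ) ∣ -A ℓ - (β + ρ ℓ))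
    (he : (2 : ℤ) ∣ (if ℓ ∣ N then 0 else 1) - (β * ρ ℓ + σ ℓ)) :
    ∀ y ∈ periodHomology L, ∃ z ∈ Λ,
      c * (haveI : NeZero ℓ := ⟨(hS ℓ hℓ).ne_zero⟩; y (heckeT (Gamma0 L) 2 ℓ F)) = (β : ℂ) * (c * y F) + 2 * z := by
  classical
  have hℓp : ℓ.Prime := hS ℓ hℓ
  haveI : NeZero ℓ := ⟨hℓp.ne_zero⟩
  intro y hy
  have hy' : y ∈ (periodHomology L : Set (Module.Dual ℂ (CuspForm (Gamma0 L) 2))) := hy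
  rw [coe_periodHomology_eq_range] at hy'
  obtain ⟨γ, rfl⟩ := hy'
  rw [periodFunctional_apply, periodFunctional_apply]
  by_cases hγ : (γ : SL(2, ℤ)) 1 0 = 0
  · exact ⟨0, Λ.zero_mem, by simp only [cuspSymbol, if_pos hγ, mul_zero, add_zero]⟩
  set r : ℚ := (((γ : SL(2, ℤ)) 0 0 : ℚ) / ((γ : SL(2, ℤ)) 1 0 : ℚ)) with hr
  rw [cuspSymbol, if_neg hγ, cuspSymbol, if_neg hγ, modularSymbol_heckeT_eq_sum ℓ F hℓp, if_pos hℓL, add_zero]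
  simp only [Int.cast_natCast]
  -- split the side operator at `ℓ`: `R = R_ℓ * R'`, `Φ = R'·ψ`
  set S' : Finset ℕ := S.erase ℓ with hS'
  set R' : MonoidAlgebra ℂ ℕ := ∏ ℓ' ∈ S', (MonoidAlgebra.single 1 (1 : ℂ) + MonoidAlgebra.single ℓ' ((ρ ℓ' : ℤ) : ℂ) +
    MonoidAlgebra.single (ℓ' ^ 2) ((σ ℓ' : ℤ) : ℂ)) with hR'
  set Φ : ℚ → ℂ := fun s ↦ R'.coeff.sum fun m a ↦ a * modularSymbol f ((m : ℚ) * s) with hΦ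
  have hsplit : ∀ s : ℚ, modularSymbol F s = Φ s + ((ρ ℓ : ℤ) : ℂ) * Φ ((ℓ : ℚ) * s) + ((σ ℓ : ℤ) : ℂ) * Φ ((((ℓ ^ 2 : ℕ) : ℚ)) * s) := by
    intro s
    rw [hF s, ← Finset.mul_prod_erase S _ hℓ, act_factor_mul]
  -- `Φ` is periodic and satisfies the `ℓ`-relation of `f` (support of `R'` prime to `ℓ`)
  have hperψ := modularSymbol_add_intCast_holds f
  have hperΦ : ∀ (x : ℚ) (k : ℤ), Φ (x + k) = Φ x := fun x k ↦ act_periodic (modularSymbol f) hperψ R' x k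
  have hρS' : ∀ ℓ' ∈ S', e ℓ' = 0 → ρ ℓ' = 0 := fun ℓ' h ↦ hρ ℓ' (Finset.mem_of_mem_erase h)
  have hσS' : ∀ ℓ' ∈ S', e ℓ' ≤ 1 → σ ℓ' = 0 := fun ℓ' h ↦ hσ ℓ' (Finset.mem_of_mem_erase h)
  have hcop : ∀ m ∈ R'.coeff.support, m.Coprime ℓ := by
    intro m hm
    refine Nat.Coprime.coprime_dvd_left (dvd_of_mem_support_prod_factor ρ σ e S' hρS' hσS' m hm) ?_
    refine Nat.coprime_prod_left_iff.mpr fun ℓ' hℓ' ↦ Nat.Coprime.pow_left _ ?_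
    exact (Nat.coprime_primes (hS ℓ' (Finset.mem_of_mem_erase hℓ')) hℓp).mpr (Finset.ne_of_mem_erase hℓ')
  have hrelψ := modularSymbol_heckeRel f hℓp (cuspCoeff f ℓ) (hT ℓ hℓp)
  have hrelΦ := heckeRel_act_of_coprime (modularSymbol f) hperψ hℓp.pos hrelψ R' hcop
  -- `U_ℓ {∞,·}_F (r) = (A + ρℓ)Φ(r) + (σℓ − 𝟙)Φ(ℓr)`, `𝟙 = I`
  have hℓ0 : (ℓ : ℂ) ≠ 0 := by exact_mod_cast hℓp.ne_zero
  set I : ℤ := (if ℓ ∣ N then 0 else 1) with hI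
  have hIℂ : (if ℓ ∣ N then (0 : ℂ) else (ℓ : ℂ)) * (ℓ : ℂ)⁻¹ = (I : ℂ) := by
    rw [hI]; split_ifs <;> simp [mul_inv_cancel₀ hℓ0]
  have hU : ∑ j : Fin ℓ, modularSymbol F ((r + j) / ℓ) =
      (((A ℓ : ℤ) : ℂ) + ((ρ ℓ : ℤ) : ℂ) * ℓ) * Φ r + (((σ ℓ : ℤ) : ℂ) * ℓ - (I : ℂ)) * Φ ((ℓ : ℚ) * r) := by
    simp only [hsplit, Finset.sum_add_distrib, ← Finset.mul_sum]
    rw [sum_fin_apply_mul_self_div Φ hperΦ hℓp.pos, sum_fin_apply_sq_mul_div Φ hperΦ hℓp.pos]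
    have h1 : ∑ j : Fin ℓ, Φ ((r + j) / ℓ) = cuspCoeff f ℓ * Φ r - (I : ℂ) * Φ ((ℓ : ℚ) * r) := by
      rw [hrelΦ r, ← hIℂ]; ring
    rw [h1, hA ℓ]
    ring
  -- integrality of `c·Φ(r)` and `c·Φ(ℓ r)`
  have hM0 : ∀ (T : Finset ℕ), (∀ ℓ' ∈ T, ℓ'.Prime) → (∏ ℓ' ∈ T, ℓ' ^ e ℓ') ≠ 0 := fun T hT ↦
    Finset.prod_ne_zero_iff.mpr fun ℓ' h ↦ pow_ne_zero _ (hT ℓ' h).ne_zero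
  have hS'p : ∀ ℓ' ∈ S', ℓ'.Prime := fun ℓ' h ↦ hS ℓ' (Finset.mem_of_mem_erase h)
  have hΛ : ∀ (d : ℕ), N * (d * ∏ ℓ' ∈ S', ℓ' ^ e ℓ') ∣ L → ∀ m : ℕ, m ∣ ∏ ℓ' ∈ S', ℓ' ^ e ℓ' →
      c * modularSymbol f ((m : ℚ) * ((d : ℚ) * r)) ∈ Λ := by
    intro d hd m hm
    have hmd : N * (m * d) ∣ L := (mul_dvd_mul_left N (by rw [mul_comm]; exact mul_dvd_mul_left d hm)).trans hd
    have hmd0 : m * d ≠ 0 := fun h ↦ by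
      rw [h, mul_zero] at hmd; exact (NeZero.ne L) (zero_dvd_iff.mp hmd)
    obtain ⟨δ, hδ, hδr⟩ := exists_gamma0_dilate_cusp hmd0 hmd γ hγ
    have h : cuspSymbol f δ = modularSymbol f ((m : ℚ) * ((d : ℚ) * r)) := by
      rw [cuspSymbol, if_neg hδ, hδr, hr]; push_cast; ring_nf
    rw [← h]
    exact hc _ (cuspSymbol_mem_periodLattice f δ)
  have hPS : (∏ ℓ' ∈ S', ℓ' ^ e ℓ') * ℓ ^ e ℓ = ∏ ℓ' ∈ S, ℓ' ^ e ℓ' := by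
    rw [mul_comm]; exact Finset.mul_prod_erase S (fun x ↦ x ^ e x) hℓ
  have hI0 : c * Φ r ∈ Λ := by
    refine mul_act_prod_factor_mem Λ (modularSymbol f) c ρ σ e S' hρS' hσS' r fun m hm ↦ ?_
    have h := hΛ 1 (by rw [one_mul]; exact (mul_dvd_mul_left N ((Dvd.intro _ hPS))).trans hL) m hm
    simpa only [Nat.cast_one, one_mul] using h
  have hI1 : 1 ≤ e ℓ → c * Φ ((ℓ : ℚ) * r) ∈ Λ := by
    intro he1
    refine mul_act_prod_factor_mem Λ (modularSymbol f) c ρ σ e S' hρS' hσS' ((ℓ : ℚ) * r) fun m hm ↦ hΛ ℓ ?_ m hm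
    refine (mul_dvd_mul_left N ?_).trans hL
    rw [← hPS, mul_comm]
    exact mul_dvd_mul_left _ (by simpa only [pow_one] using pow_dvd_pow ℓ he1)
  -- the integers `k₀ = (A + ρℓ − β)/2 = −u + ρt − β`, `k₁ = (σℓ − 𝟙 − βρ)/2 = σt − v − βρ` (`ℓ = 2t + 1`)
  obtain ⟨t, ht⟩ := hℓodd
  obtain ⟨u, hu⟩ := hb
  obtain ⟨v, hv⟩ := he
  have ht' : (ℓ : ℂ) = 2 * (t : ℂ) + 1 := by exact_mod_cast ht
  have hu' : -((A ℓ : ℤ) : ℂ) - (((β : ℤ) : ℂ) + ((ρ ℓ : ℤ) : ℂ)) = 2 * (u : ℂ) := by exact_mod_cast hu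
  have hv' : ((I : ℤ) : ℂ) - (((β : ℤ) : ℂ) * ((ρ ℓ : ℤ) : ℂ) + ((σ ℓ : ℤ) : ℂ)) = 2 * (v : ℂ) := by exact_mod_cast hv
  have hx' : ((β : ℤ) : ℂ) * ((σ ℓ : ℤ) : ℂ) = 0 := by exact_mod_cast hx
  -- the `Φ(ℓ r)`-coefficient `k₁` vanishes unless `e ℓ ≥ 1`
  have hk₁ : (σ ℓ * (t : ℤ) - v - β * ρ ℓ : ℤ) • (c * Φ ((ℓ : ℚ) * r)) ∈ Λ := by
    by_cases he0 : e ℓ = 0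
    · have hρ0 := hρ ℓ hℓ he0
      have hσ0 := hσ ℓ hℓ (by omega)
      rw [hρ0, hσ0, hI] at hv
      have hv0 : v = 0 := by split_ifs at hv <;> omega
      rw [hρ0, hσ0, hv0]
      simp only [zero_mul, mul_zero, sub_self, zero_smul]
      exact Λ.zero_mem
    · exact Λ.zsmul_mem (hI1 (Nat.one_le_iff_ne_zero.mpr he0)) _
  refine ⟨(-u + ρ ℓ * (t : ℤ) - β : ℤ) • (c * Φ r) + (σ ℓ * (t : ℤ) - v - β * ρ ℓ : ℤ) • (c * Φ ((ℓ : ℚ) * r)),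
    Λ.add_mem (Λ.zsmul_mem hI0 _) hk₁, ?_⟩
  rw [hU, hsplit r, zsmul_eq_mul, zsmul_eq_mul]
  simp only [Int.cast_sub, Int.cast_add, Int.cast_neg, Int.cast_mul, Int.cast_natCast]
  linear_combination (c * Φ r * ((ρ ℓ : ℤ) : ℂ) + c * Φ ((ℓ : ℚ) * r) * ((σ ℓ : ℤ) : ℂ)) * ht' - (c * Φ r) * hu' -
    (c * Φ ((ℓ : ℚ) * r)) * hv' - (c * Φ ((((ℓ ^ 2 : ℕ) : ℚ)) * r)) * hx'

/-! ## §4 The common mod-`2` eigen-ideal kills the half-periods of the generalised old form -/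

/-- **«`θ_F` kills `𝔪·J₀(L)[2]`» for the generalised old form.** Data as in `apply_heckeT_factorForm_of_mem` at EVERY `ℓ ∈ S` (integers `β_ℓ` with the
reduction's constraints), `S` a set of odd primes dividing `L` and containing every prime of `L`, `N·∏ℓ^{e_ℓ} ∣ L`. For every `t` in the ideal of `𝕋_ℤ(L)`
generated by `2`, the `T_p − a_p(f)` (`p` prime, `p ∉ S`) and the `T_ℓ − β_ℓ` (`ℓ ∈ S`), and every `y ∈ H₁(X₀(L);ℤ)`: **`c·(t•y)(F)/2 ∈ Λ`**. In the reduction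
of `…KilfordCopyCrossLevelFactorConductor` BOTH canonical old forms `F₁, F₂` satisfy this with the SAME generators (`a_p(f₁) ≡ a_p(f₂)` off `S`, common `β_ℓ`
on `S`): the Hecke half of the level-`L` carrier rows for `θᵢ = Dᵢ.jacobiMapForm L Fᵢ`. [cite: DarmonDiamondTaylor1995, §1.3 and §4.1]
[cite: CremonaAlgorithms1997, §2.4 and §2.10] [cite: DiamondShurman2005, Prop. 5.6.2] -/
theorem factorForm_half_smul_mem_of_mem_span {N L : ℕ} [NeZero N] [NeZero L] (f : CuspForm (Gamma0 N) 2) (A : ℕ → ℤ)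
    (hA : ∀ n, cuspCoeff f n = A n)
    (hT : ∀ (p : ℕ) (hp : p.Prime), (haveI : NeZero p := ⟨hp.ne_zero⟩; heckeT (Gamma0 N) 2 p f) = cuspCoeff f p • f)
    (ρ σ : ℕ → ℤ) (e : ℕ → ℕ) (S : Finset ℕ) (hS : ∀ ℓ ∈ S, ℓ.Prime) (hSodd : ∀ ℓ ∈ S, Odd ℓ)
    (hρ : ∀ ℓ ∈ S, e ℓ = 0 → ρ ℓ = 0) (hσ : ∀ ℓ ∈ S, e ℓ ≤ 1 → σ ℓ = 0) (hL : N * ∏ ℓ ∈ S, ℓ ^ e ℓ ∣ L)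
    (hSL : ∀ ℓ ∈ S, ℓ ∣ L) (hLS : ∀ p : ℕ, p.Prime → p ∣ L → p ∈ S)
    (F : CuspForm (Gamma0 L) 2)
    (hF : ∀ s : ℚ, modularSymbol F s =
      ((∏ ℓ ∈ S, (MonoidAlgebra.single 1 (1 : ℂ) + MonoidAlgebra.single ℓ ((ρ ℓ : ℤ) : ℂ) +
        MonoidAlgebra.single (ℓ ^ 2) ((σ ℓ : ℤ) : ℂ)) : MonoidAlgebra ℂ ℕ).coeff.sum fun m a ↦ a * modularSymbol f ((m : ℚ) * s)))
    (Λ : AddSubgroup ℂ) (c : ℂ) (hc : ∀ z ∈ periodLattice f, c * z ∈ Λ)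
    (β : ℕ → ℤ) (hx : ∀ ℓ ∈ S, β ℓ * σ ℓ = 0) (hb : ∀ ℓ ∈ S, (2 : ℤ) ∣ -A ℓ - (β ℓ + ρ ℓ))
    (he : ∀ ℓ ∈ S, (2 : ℤ) ∣ (if ℓ ∣ N then 0 else 1) - (β ℓ * ρ ℓ + σ ℓ))
    {t : HeckeRing0 L 2}
    (ht : t ∈ Ideal.span ({t : HeckeRing0 L 2 | t = 2 ∨ (∃ (p : ℕ) (hp : p.Prime), p ∉ S ∧ t = HeckeRing0.T L 2 p hp - (A p : HeckeRing0 L 2)) ∨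
      (∃ (ℓ : ℕ) (hℓ : ℓ ∈ S), t = HeckeRing0.T L 2 ℓ (hS ℓ hℓ) - (β ℓ : HeckeRing0 L 2))}))
    (y : periodHomologyHecke L) :
    c * ((t • y : periodHomologyHecke L) : Module.Dual ℂ (CuspForm (Gamma0 L) 2)) F / 2 ∈ Λ := by
  classical
  have hS0 : ∀ ℓ ∈ S, ℓ ≠ 0 := fun ℓ hℓ ↦ (hS ℓ hℓ).ne_zero
  have hNL : N ∣ L := (Dvd.intro _ rfl).trans hL
  revert y
  refine Submodule.span_induction ?_ ?_ ?_ ?_ ht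
  · -- generators
    rintro s (rfl | ⟨p, hp, hpS, rfl⟩ | ⟨ℓ, hℓ, rfl⟩) y
    · -- `s = 2`: `c·(2y)(F)/2 = c·y(F)`
      rw [Submodule.coe_smul, HeckeRing0.smul_dual_apply, map_ofNat, Module.End.ofNat_apply, map_nsmul, nsmul_eq_mul, Nat.cast_ofNat]
      have h : c * (2 * (y : Module.Dual ℂ (CuspForm (Gamma0 L) 2)) F) / 2 = c * (y : Module.Dual ℂ (CuspForm (Gamma0 L) 2)) F := by ring
      rw [h]
      exact factorForm_mul_apply_mem f ρ σ e S hS0 hρ hσ hL F hF Λ c hc _ y.2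
    · -- `s = T_p − A p`, `p ∉ S`: `y(T_p F) = a_p·y(F)` (`p ∤ L`, `p ∤ N`)
      haveI : NeZero p := ⟨hp.ne_zero⟩
      have hpL : ¬ p ∣ L := fun h ↦ hpS (hLS p hp h)
      have hpN : ¬ p ∣ N := fun h ↦ hpL (h.trans hNL)
      have hTp : heckeT (Gamma0 N) 2 p f = ((A p : ℤ) : ℂ) • f := by rw [hT p hp, hA p]
      have hyT := apply_heckeT_factorForm_of_not_mem f ρ σ e S hS hρ hσ F hF hp hpS hpN hpL _ hTp _ y.2
      rw [Submodule.coe_smul, HeckeRing0.smul_dual_apply, map_sub, HeckeRing0.toEnd_T, map_intCast, LinearMap.sub_apply, Module.End.intCast_apply, map_sub,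
        hyT, map_zsmul, zsmul_eq_mul, sub_self, mul_zero, zero_div]
      exact Λ.zero_mem
    · -- `s = T_ℓ − β_ℓ`, `ℓ ∈ S`: `c·y(U_ℓ F) = β_ℓ·c·y(F) + 2z`
      obtain ⟨z, hz, hzeq⟩ := apply_heckeT_factorForm_of_mem f A hA hT ρ σ e S hS hρ hσ hL F hF Λ c hc hℓ (hSodd ℓ hℓ) (hSL ℓ hℓ) (β ℓ)
        (hx ℓ hℓ) (hb ℓ hℓ) (he ℓ hℓ) _ y.2
      haveI : NeZero ℓ := ⟨(hS ℓ hℓ).ne_zero⟩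
      rw [Submodule.coe_smul, HeckeRing0.smul_dual_apply, map_sub, HeckeRing0.toEnd_T, map_intCast, LinearMap.sub_apply, Module.End.intCast_apply,
        map_sub, map_zsmul, zsmul_eq_mul, mul_sub, hzeq]
      have h : (((β ℓ : ℤ) : ℂ) * (c * (y : Module.Dual ℂ (CuspForm (Gamma0 L) 2)) F) + 2 * z -
          c * (((β ℓ : ℤ) : ℂ) * (y : Module.Dual ℂ (CuspForm (Gamma0 L) 2)) F)) / 2 = z := by ring
      rw [h]
      exact hz
  · -- `0`
    intro y
    rw [zero_smul, Submodule.coe_zero, LinearMap.zero_apply, mul_zero, zero_div]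
    exact Λ.zero_mem
  · -- `+`
    intro s₁ s₂ _ _ h₁ h₂ y
    rw [add_smul, Submodule.coe_add, LinearMap.add_apply, mul_add, add_div]
    exact Λ.add_mem (h₁ y) (h₂ y)
  · -- `r • s`
    intro r s _ hs y
    rw [smul_eq_mul, show r * s = s * r from mul_comm r s, mul_smul]
    exact hs (r • y)

end Summit.BirchSwinnertonDyer.BirchSwinnertonDyer.Theorems.AlignedTransportAtTwoKilfordCopyCrossLevelFactorHecke

end
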